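import Literature.Probability.ODonnellSaksSchrammServedio2005.BiasedCube
import HarnessLib

/-!
# RSW3 lane (lead, gen 20): NOISE SENSITIVITY OF CROSSINGS, I — p-biased Fourier–Walsh analysis on a finite product cube,
# with degenerate coordinates allowed

builds on p205010 (kernel theorem, internal audit signed; external expert review pending) — NOT used in this file (abstract).

Cell `prim-rsw3` (LANE 3), lead seat, gen 20.  Support file (`--supports stmt-CriticalPhenomena-4575`); no definitions, no named facts,
no sorries.  The lane's box cube (`HutchcroftVolumeBoxCube`: all pairs of `Λ(N)` as coordinates, bias `p` on lattice edges and bias `0`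
on the other pairs; product weight `wt`) has DEGENERATE coordinates, so the Fourier–Walsh analysis is set up for biases `p_i ∈ [0,1]`:
a "character system" is any `r : ι → Bool → ℝ` with

* (H1) `p_i·r_i(1) + (1 − p_i)·r_i(0) = 0` (mean zero), and
* (H2) `w_i(b')·(1 + r_i(b)·r_i(b')) = 𝟙[b' = b]` whenever `w_i(b) ≠ 0` (`w_i(1) = p_i`, `w_i(0) = 1 − p_i`) (reproducing kernel),

which the p-biased characters `r_i(b) = (𝟙[b] − p_i)/√(p_i(1−p_i))` satisfy for EVERY `p_i ∈ [0,1]` (`/0 = 0` makes `r_i ≡ 0` at a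
degenerate coordinate) — `pbiased_H1`, `pbiased_H2`.  Walsh characters `χ_S(x) = Π_{i∈S} r_i(x_i)` and coefficients
`f̂(S) = Σ_x wt(x)·f(x)·χ_S(x)` are written out (no definitions).  Proved, for any character system:

* `sum_wt_mul_prod` / `sum_wt_mul_prod_finset` — `E[Π_i φ_i(x_i)] = Π_i (p_i φ_i(1) + (1−p_i) φ_i(0))` (independence);
* `sum_wt_mul_char_mul_char` — orthogonality `E[χ_S χ_T] = 0` for `S ≠ T` (H1); `sum_wt_mul_char_sq_le_one`, `coeff_mul_sum_wt_char_sq` —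
  `E[χ_S²] ≤ 1` and `f̂(S)·E[χ_S²] = f̂(S)` (a degenerate `S` has `χ_S = 0` a.e.) (H2);
* `prod_coordWt_mul_kernel` — the reproducing kernel `wt(y)·Π_i(1 + r_i(x_i) r_i(y_i)) = 𝟙[y = x]` for `wt(x) ≠ 0` (H2);
* **`sum_coeff_mul_char`** — THE WALSH EXPANSION `Σ_S f̂(S)·χ_S(x) = f(x)` at every `x` of positive weight; **`sum_wt_mul_mul_eq_sum_coeff`** —
  PLANCHEREL `E[f·h] = Σ_S f̂(S)·ĥ(S)`; `sum_wt_mul_sq_eq_sum_coeff_sq` — PARSEVAL.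

References: R. O'Donnell, *Analysis of Boolean Functions*, CUP 2014, §8.4 (p-biased Fourier analysis: the basis `φ(x_i) = (x_i − μ)/σ`,
Prop. 8.29/Thm 8.30 orthonormal decomposition, Parseval); C. Garban, J. Steif, *Noise sensitivity of Boolean functions and percolation*,
CUP 2014, Ch. IV §1 (the same for `p ≠ 1/2`).
-/

noncomputable section

namespace Summit.CriticalPhenomena.PercolationContinuityZ3.Theorems.Crossing.Spectral

open Finset Function
open Literature.Probability.ODonnellSaksSchrammServedio2005

variable {ι : Type*}

/-! ## §1 Independence: expectations of products of one-coordinate functions -/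

section Independence

variable [Fintype ι] [DecidableEq ι]

/-- **Independence of the coordinates**: `E_p[Π_i φ_i(x_i)] = Π_i (p_i·φ_i(1) + (1 − p_i)·φ_i(0))`.
[cite: ODonnell2014, §8.4 (the p-biased product distribution π_p^{⊗n})] -/
theorem sum_wt_mul_prod (p : ι → ℝ) (φ : ι → Bool → ℝ) :
    ∑ x : ι → Bool, wt p x * ∏ i, φ i (x i) = ∏ i, (p i * φ i true + (1 - p i) * φ i false) := by
  have h1 : ∀ x : ι → Bool, wt p x * ∏ i, φ i (x i) = ∏ i, (coordWt p i (x i) * φ i (x i)) := by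
    intro x
    unfold wt
    rw [Finset.prod_mul_distrib]
  simp_rw [h1]
  rw [← Fintype.prod_sum (fun i b => coordWt p i b * φ i b)]
  refine Finset.prod_congr rfl fun i _ => ?_
  rw [Fintype.sum_bool]
  simp [coordWt]

/-- Finset form: `E_p[Π_{i∈S} φ_i(x_i)] = Π_{i∈S} (p_i·φ_i(1) + (1 − p_i)·φ_i(0))`.
[cite: ODonnell2014, §8.4 (the p-biased product distribution π_p^{⊗n})] -/
theorem sum_wt_mul_prod_finset (p : ι → ℝ) (S : Finset ι) (φ : ι → Bool → ℝ) :
    ∑ x : ι → Bool, wt p x * ∏ i ∈ S, φ i (x i) = ∏ i ∈ S, (p i * φ i true + (1 - p i) * φ i false) := by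
  have h := sum_wt_mul_prod p (fun i b => if i ∈ S then φ i b else 1)
  have h1 : ∀ x : ι → Bool, (∏ i, (fun i b => if i ∈ S then φ i b else (1 : ℝ)) i (x i)) = ∏ i ∈ S, φ i (x i) := by
    intro x
    exact Fintype.prod_ite_mem S (fun i => φ i (x i))
  simp_rw [h1] at h
  rw [h, ← Fintype.prod_ite_mem S]
  refine Finset.prod_congr rfl fun i _ => ?_
  split_ifs <;> ring

end Independence

/-! ## §2 One coordinate: consequences of (H1), (H2) -/

section OneCoordinate

variable {p : ι → ℝ} (h0 : ∀ i, 0 ≤ p i) (h1 : ∀ i, p i ≤ 1) {r : ι → Bool → ℝ}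
  (hH2 : ∀ i (b b' : Bool), coordWt p i b ≠ 0 → coordWt p i b' * (1 + r i b * r i b') = if b' = b then 1 else 0)

include hH2 in
/-- (H2) on the diagonal: `w_i(b)·(1 + r_i(b)²) = 1` when `w_i(b) ≠ 0`. [cite: ODonnell2014, §8.4 Def 8.40 (φ has mean 0 and variance 1)] -/
theorem coordWt_mul_one_add_sq (i : ι) (b : Bool) (hb : coordWt p i b ≠ 0) : coordWt p i b * (1 + r i b * r i b) = 1 := by
  have h := hH2 i b b hb
  rwa [if_pos rfl] at h

include hH2 in
/-- Second moment at a NONDEGENERATE coordinate (`0 < p_i < 1`): `p_i r_i(1)² + (1−p_i) r_i(0)² = 1`.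
[cite: ODonnell2014, §8.4 Def 8.40 (φ(x_i) = (x_i − μ)/σ has variance 1)] -/
theorem second_moment_eq_one (i : ι) (hp0 : 0 < p i) (hp1 : p i < 1) :
    p i * (r i true * r i true) + (1 - p i) * (r i false * r i false) = 1 := by
  have ht := coordWt_mul_one_add_sq hH2 i true (by simp [coordWt]; exact hp0.ne')
  have hf := coordWt_mul_one_add_sq hH2 i false (by simp [coordWt]; linarith)
  simp only [coordWt, if_true, Bool.false_eq_true, if_false] at ht hf
  linarith

include h0 h1 hH2 in
/-- At a DEGENERATE coordinate (`p_i ∈ {0,1}`) the character vanishes on the value of positive weight: `w_i(b) ≠ 0 ⇒ r_i(b) = 0`.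
[cite: ODonnell2014, §8.4 (p-biased analysis requires p ∈ (0,1); degenerate coordinates are constants)] -/
theorem char_eq_zero_of_degenerate (i : ι) (hdeg : ¬(0 < p i ∧ p i < 1)) (b : Bool) (hb : coordWt p i b ≠ 0) : r i b = 0 := by
  have h := coordWt_mul_one_add_sq hH2 i b hb
  -- `w_i(b) = 1` since the other value has weight `0`
  have hw : coordWt p i b = 1 := by
    have h0i := h0 i
    have h1i := h1 i
    rcases Bool.eq_false_or_eq_true b with hb' | hb'
    · subst hb'
      simp only [coordWt, if_true] at hb ⊢
      by_contra hne
      exact hdeg ⟨lt_of_le_of_ne h0i (Ne.symm hb), lt_of_le_of_ne h1i hne⟩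
    · subst hb'
      simp only [coordWt, Bool.false_eq_true, if_false] at hb ⊢
      by_contra hne
      have : p i ≠ 0 := fun h => hne (by rw [h]; ring)
      exact hdeg ⟨lt_of_le_of_ne h0i (Ne.symm this), lt_of_le_of_ne h1i (fun h => hb (by rw [h]; ring))⟩
  rw [hw, one_mul] at h
  nlinarith [sq_nonneg (r i b)]

include h0 h1 hH2 in
/-- Second moment in general: `p_i r_i(1)² + (1−p_i) r_i(0)² ∈ {0, 1}` — `1` at a nondegenerate coordinate, `0` at a degenerate one.
[cite: ODonnell2014, §8.4 Def 8.40 (variance of the basis function)] -/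
theorem second_moment_eq_ite (i : ι) :
    p i * (r i true * r i true) + (1 - p i) * (r i false * r i false) = if (0 < p i ∧ p i < 1) then 1 else 0 := by
  split_ifs with hnd
  · exact second_moment_eq_one hH2 i hnd.1 hnd.2
  · -- degenerate: `p_i = 0` or `p_i = 1`
    have h0i := h0 i
    have h1i := h1 i
    by_cases hz : p i = 0
    · have hr := char_eq_zero_of_degenerate h0 h1 hH2 i hnd false (by simp [coordWt, hz])
      rw [hz, hr]; ring
    · have hone : p i = 1 := by
        by_contra hne
        exact hnd ⟨lt_of_le_of_ne h0i (Ne.symm hz), lt_of_le_of_ne h1i hne⟩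
      have hr := char_eq_zero_of_degenerate h0 h1 hH2 i hnd true (by simp [coordWt, hone])
      rw [hone, hr]; ring

end OneCoordinate

/-! ## §3 Orthogonality and norms of the Walsh characters `χ_S(x) = Π_{i∈S} r_i(x_i)` -/

section Characters

variable [Fintype ι] [DecidableEq ι] {p : ι → ℝ} (h0 : ∀ i, 0 ≤ p i) (h1 : ∀ i, p i ≤ 1) {r : ι → Bool → ℝ}
  (hH1 : ∀ i, p i * r i true + (1 - p i) * r i false = 0)
  (hH2 : ∀ i (b b' : Bool), coordWt p i b ≠ 0 → coordWt p i b' * (1 + r i b * r i b') = if b' = b then 1 else 0)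

include hH1 in
/-- **ORTHOGONALITY**: `E_p[χ_S·χ_T] = 0` for `S ≠ T` (a coordinate of `S ∆ T` contributes the factor `E[r_i] = 0`).
[cite: ODonnell2014, §8.4 Prop 8.29 (the φ_S are orthonormal)] -/
theorem sum_wt_mul_char_mul_char {S T : Finset ι} (hST : S ≠ T) :
    ∑ x : ι → Bool, wt p x * ((∏ i ∈ S, r i (x i)) * ∏ i ∈ T, r i (x i)) = 0 := by
  -- write the integrand as a product over all coordinates
  have hprod : ∀ x : ι → Bool, (∏ i ∈ S, r i (x i)) * ∏ i ∈ T, r i (x i)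
      = ∏ i, ((if i ∈ S then r i (x i) else 1) * (if i ∈ T then r i (x i) else 1)) := by
    intro x
    rw [Finset.prod_mul_distrib, Fintype.prod_ite_mem, Fintype.prod_ite_mem]
  simp_rw [hprod]
  rw [sum_wt_mul_prod p (fun i b => (if i ∈ S then r i b else 1) * (if i ∈ T then r i b else 1))]
  -- a coordinate in the symmetric difference
  obtain ⟨i, hi⟩ : ∃ i, (i ∈ S ∧ i ∉ T) ∨ (i ∈ T ∧ i ∉ S) := by
    have hnot : ¬(S ⊆ T ∧ T ⊆ S) := fun h => hST (Finset.Subset.antisymm h.1 h.2)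
    rcases not_and_or.1 hnot with h | h
    · obtain ⟨i, hi, hi'⟩ := Finset.not_subset.1 h
      exact ⟨i, Or.inl ⟨hi, hi'⟩⟩
    · obtain ⟨i, hi, hi'⟩ := Finset.not_subset.1 h
      exact ⟨i, Or.inr ⟨hi, hi'⟩⟩
  apply Finset.prod_eq_zero (Finset.mem_univ i)
  rcases hi with ⟨hiS, hiT⟩ | ⟨hiT, hiS⟩
  · simp only [if_pos hiS, if_neg hiT, mul_one]; exact hH1 i
  · simp only [if_neg hiS, if_pos hiT, one_mul]; exact hH1 i

include h0 h1 hH2 in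
/-- **NORM OF A CHARACTER**: `E_p[χ_S²] = 1` if every coordinate of `S` is nondegenerate, `0` otherwise.
[cite: ODonnell2014, §8.4 Prop 8.29 (the φ_S are orthonormal)] -/
theorem sum_wt_mul_char_sq (S : Finset ι) :
    ∑ x : ι → Bool, wt p x * ((∏ i ∈ S, r i (x i)) * ∏ i ∈ S, r i (x i))
      = if (∀ i ∈ S, 0 < p i ∧ p i < 1) then 1 else 0 := by
  have hprod : ∀ x : ι → Bool, (∏ i ∈ S, r i (x i)) * ∏ i ∈ S, r i (x i) = ∏ i ∈ S, (r i (x i) * r i (x i)) := by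
    intro x; rw [← Finset.prod_mul_distrib]
  simp_rw [hprod]
  rw [sum_wt_mul_prod_finset p S (fun i b => r i b * r i b)]
  simp_rw [second_moment_eq_ite h0 h1 hH2]
  split_ifs with hall
  · exact Finset.prod_eq_one fun i hi => if_pos (hall i hi)
  · simp only [not_forall] at hall
    obtain ⟨i, hiS, hi⟩ := hall
    exact Finset.prod_eq_zero hiS (if_neg hi)

include h0 h1 hH2 in
/-- `0 ≤ E_p[χ_S²] ≤ 1`. [cite: ODonnell2014, §8.4 Prop 8.29 (the φ_S are orthonormal)] -/
theorem sum_wt_mul_char_sq_le_one (S : Finset ι) :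
    ∑ x : ι → Bool, wt p x * ((∏ i ∈ S, r i (x i)) * ∏ i ∈ S, r i (x i)) ≤ 1 := by
  rw [sum_wt_mul_char_sq h0 h1 hH2 S]; split_ifs <;> norm_num

omit [DecidableEq ι] in
include h0 h1 hH2 in
/-- A character with a DEGENERATE coordinate vanishes almost everywhere: `wt(x) ≠ 0 ⇒ χ_S(x) = 0`.
[cite: ODonnell2014, §8.4 (degenerate coordinates are constants)] -/
theorem char_eq_zero_of_exists_degenerate {S : Finset ι} (hS : ¬ ∀ i ∈ S, 0 < p i ∧ p i < 1) {x : ι → Bool} (hx : wt p x ≠ 0) :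
    ∏ i ∈ S, r i (x i) = 0 := by
  simp only [not_forall] at hS
  obtain ⟨i, hiS, hi⟩ := hS
  apply Finset.prod_eq_zero hiS
  have hxi : coordWt p i (x i) ≠ 0 := by
    unfold wt at hx
    exact (Finset.prod_ne_zero_iff.1 hx) i (Finset.mem_univ i)
  exact char_eq_zero_of_degenerate h0 h1 hH2 i hi (x i) hxi

include h0 h1 hH2 in
/-- **`f̂(S)·E[χ_S²] = f̂(S)`**: either `E[χ_S²] = 1`, or `S` has a degenerate coordinate and then `f̂(S) = 0`.
[cite: ODonnell2014, §8.4 Prop 8.29 (orthonormality ⇒ f̂(S) = ⟨f, φ_S⟩)] -/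
theorem coeff_mul_sum_wt_char_sq (f : (ι → Bool) → ℝ) (S : Finset ι) :
    (∑ x : ι → Bool, wt p x * (f x * ∏ i ∈ S, r i (x i)))
        * (∑ x : ι → Bool, wt p x * ((∏ i ∈ S, r i (x i)) * ∏ i ∈ S, r i (x i)))
      = ∑ x : ι → Bool, wt p x * (f x * ∏ i ∈ S, r i (x i)) := by
  rw [sum_wt_mul_char_sq h0 h1 hH2 S]
  split_ifs with hall
  · rw [mul_one]
  · rw [mul_zero]
    symm
    refine Finset.sum_eq_zero fun x _ => ?_
    by_cases hx : wt p x = 0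
    · rw [hx, zero_mul]
    · rw [char_eq_zero_of_exists_degenerate h0 h1 hH2 hall hx]; ring

/-! ## §4 The reproducing kernel, the Walsh expansion, Plancherel and Parseval -/

omit [DecidableEq ι] in
include hH2 in
/-- **THE REPRODUCING KERNEL**: for `wt(x) ≠ 0`, `wt(y)·Π_i (1 + r_i(x_i)·r_i(y_i)) = 𝟙[y = x]`.
[cite: ODonnell2014, §8.4 Thm 8.30 (f = Σ_S f̂(S) φ_S; equivalently Σ_S φ_S(x)φ_S(y) π_p(y) = 𝟙[x = y])] -/
theorem prod_coordWt_mul_kernel {x : ι → Bool} (hx : wt p x ≠ 0) (y : ι → Bool) :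
    ∏ i, (coordWt p i (y i) * (1 + r i (x i) * r i (y i))) = if y = x then 1 else 0 := by
  have hxi : ∀ i, coordWt p i (x i) ≠ 0 := by
    unfold wt at hx
    exact fun i => (Finset.prod_ne_zero_iff.1 hx) i (Finset.mem_univ i)
  split_ifs with hyx
  · subst hyx
    exact Finset.prod_eq_one fun i _ => by rw [hH2 i (y i) (y i) (hxi i), if_pos rfl]
  · obtain ⟨i, hi⟩ : ∃ i, y i ≠ x i := Function.ne_iff.1 hyx
    exact Finset.prod_eq_zero (Finset.mem_univ i) (by rw [hH2 i (x i) (y i) (hxi i), if_neg hi])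

include hH2 in
/-- **THE WALSH EXPANSION**: `Σ_S f̂(S)·χ_S(x) = f(x)` at every `x` of positive weight (all `x` when every `p_i ∈ (0,1)`).
[cite: ODonnell2014, §8.4 Thm 8.30 (every f has the unique expansion f = Σ_S f̂(S) φ_S)] -/
theorem sum_coeff_mul_char (f : (ι → Bool) → ℝ) {x : ι → Bool} (hx : wt p x ≠ 0) :
    ∑ S ∈ (Finset.univ : Finset ι).powerset,
        (∑ y : ι → Bool, wt p y * (f y * ∏ i ∈ S, r i (y i))) * ∏ i ∈ S, r i (x i) = f x := by
  -- exchange the sums and resum the kernel `Σ_S χ_S(y) χ_S(x) = Π_i (1 + r_i(x_i) r_i(y_i))`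
  have hker : ∀ y : ι → Bool, ∑ S ∈ (Finset.univ : Finset ι).powerset, (∏ i ∈ S, r i (y i)) * ∏ i ∈ S, r i (x i)
      = ∏ i, (1 + r i (x i) * r i (y i)) := by
    intro y
    rw [Finset.prod_one_add]
    refine Finset.sum_congr rfl fun S _ => ?_
    rw [← Finset.prod_mul_distrib]
    exact Finset.prod_congr rfl fun i _ => mul_comm _ _
  calc ∑ S ∈ (Finset.univ : Finset ι).powerset,
        (∑ y : ι → Bool, wt p y * (f y * ∏ i ∈ S, r i (y i))) * ∏ i ∈ S, r i (x i)
      = ∑ y : ι → Bool, wt p y * f y *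
          ∑ S ∈ (Finset.univ : Finset ι).powerset, (∏ i ∈ S, r i (y i)) * ∏ i ∈ S, r i (x i) := by
        simp only [Finset.sum_mul, Finset.mul_sum]
        rw [Finset.sum_comm]
        exact Finset.sum_congr rfl fun y _ => Finset.sum_congr rfl fun S _ => by ring
    _ = ∑ y : ι → Bool, f y * ∏ i, (coordWt p i (y i) * (1 + r i (x i) * r i (y i))) := by
        refine Finset.sum_congr rfl fun y _ => ?_
        rw [hker y, Finset.prod_mul_distrib]
        unfold wt
        ring
    _ = ∑ y : ι → Bool, f y * (if y = x then 1 else 0) := by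
        refine Finset.sum_congr rfl fun y _ => ?_
        rw [prod_coordWt_mul_kernel hH2 hx y]
    _ = f x := by simp

include hH2 in
/-- **PLANCHEREL**: `E_p[f·h] = Σ_S f̂(S)·ĥ(S)` (every `p ∈ [0,1]^ι`).
[cite: ODonnell2014, §8.4 (Plancherel / Parseval for the p-biased expansion, after Thm 8.30)] -/
theorem sum_wt_mul_mul_eq_sum_coeff (f h : (ι → Bool) → ℝ) :
    ∑ x : ι → Bool, wt p x * (f x * h x)
      = ∑ S ∈ (Finset.univ : Finset ι).powerset,
          (∑ y : ι → Bool, wt p y * (f y * ∏ i ∈ S, r i (y i))) * (∑ y : ι → Bool, wt p y * (h y * ∏ i ∈ S, r i (y i))) := by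
  symm
  calc ∑ S ∈ (Finset.univ : Finset ι).powerset,
        (∑ y : ι → Bool, wt p y * (f y * ∏ i ∈ S, r i (y i))) * (∑ y : ι → Bool, wt p y * (h y * ∏ i ∈ S, r i (y i)))
      = ∑ x : ι → Bool, wt p x * h x * ∑ S ∈ (Finset.univ : Finset ι).powerset,
          (∑ y : ι → Bool, wt p y * (f y * ∏ i ∈ S, r i (y i))) * ∏ i ∈ S, r i (x i) := by
        simp only [Finset.mul_sum]
        rw [Finset.sum_comm]
        exact Finset.sum_congr rfl fun S _ => Finset.sum_congr rfl fun x _ => by ring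
    _ = ∑ x : ι → Bool, wt p x * (f x * h x) := by
        refine Finset.sum_congr rfl fun x _ => ?_
        by_cases hx : wt p x = 0
        · rw [hx]; ring
        · rw [sum_coeff_mul_char hH2 f hx]; ring

include hH2 in
/-- **PARSEVAL**: `E_p[f²] = Σ_S f̂(S)²`. [cite: ODonnell2014, §8.4 (Parseval for the p-biased expansion)] -/
theorem sum_wt_mul_sq_eq_sum_coeff_sq (f : (ι → Bool) → ℝ) :
    ∑ x : ι → Bool, wt p x * (f x * f x)
      = ∑ S ∈ (Finset.univ : Finset ι).powerset, (∑ y : ι → Bool, wt p y * (f y * ∏ i ∈ S, r i (y i))) ^ 2 := by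
  rw [sum_wt_mul_mul_eq_sum_coeff hH2 f f]
  exact Finset.sum_congr rfl fun S _ => by ring

end Characters

/-! ## §5 The p-biased characters satisfy (H1) and (H2) at every `p ∈ [0,1]^ι` -/

/-- **(H1) for the p-biased characters** `r_i(b) = (𝟙[b] − p_i)/√(p_i(1−p_i))`: mean zero (trivially also at a degenerate coordinate, where
`/0 = 0`). [cite: ODonnell2014, §8.4 Def 8.40 (φ(x_i) = (x_i − μ_i)/σ_i)] -/
theorem pbiased_H1 (p : ι → ℝ) (i : ι) :
    p i * (((if true then (1 : ℝ) else 0) - p i) / Real.sqrt (p i * (1 - p i)))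
      + (1 - p i) * (((if false then (1 : ℝ) else 0) - p i) / Real.sqrt (p i * (1 - p i))) = 0 := by
  simp only [if_true, Bool.false_eq_true, if_false]
  ring

/-- **(H2) for the p-biased characters** (the reproducing kernel at one coordinate), every `p_i ∈ [0,1]`:
`w_i(b')·(1 + r_i(b) r_i(b')) = 𝟙[b' = b]` whenever `w_i(b) ≠ 0`. [cite: ODonnell2014, §8.4 Thm 8.30 (orthonormal basis {φ_S})] -/
theorem pbiased_H2 (p : ι → ℝ) (h0 : ∀ i, 0 ≤ p i) (h1 : ∀ i, p i ≤ 1) (i : ι) (b b' : Bool) (hb : coordWt p i b ≠ 0) :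
    coordWt p i b' * (1 + (((if b then (1 : ℝ) else 0) - p i) / Real.sqrt (p i * (1 - p i)))
        * (((if b' then (1 : ℝ) else 0) - p i) / Real.sqrt (p i * (1 - p i))))
      = if b' = b then 1 else 0 := by
  have h0i := h0 i
  have h1i := h1 i
  by_cases hnd : 0 < p i ∧ p i < 1
  · -- nondegenerate: `r_i(b) r_i(b') = (𝟙b − p)(𝟙b' − p)/(p(1−p))`
    have hss : Real.sqrt (p i * (1 - p i)) * Real.sqrt (p i * (1 - p i)) = p i * (1 - p i) :=
      Real.mul_self_sqrt (by nlinarith)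
    have key : ∀ B B' : ℝ, (B - p i) / Real.sqrt (p i * (1 - p i)) * ((B' - p i) / Real.sqrt (p i * (1 - p i)))
        = (B - p i) * (B' - p i) / (p i * (1 - p i)) := by
      intro B B'; rw [div_mul_div_comm, hss]
    have hq0 : p i ≠ 0 := hnd.1.ne'
    have hq1 : 1 - p i ≠ 0 := by linarith [hnd.2]
    rw [key]
    cases b <;> cases b' <;> simp only [coordWt, Bool.false_eq_true, Bool.true_eq_false, if_false, if_true]
      <;> field_simp <;> ring
  · -- degenerate: `p_i = 0` (then `b = false`) or `p_i = 1` (then `b = true`); the characters vanish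
    have hdeg : p i = 0 ∨ p i = 1 := by
      rcases eq_or_lt_of_le h0i with h | h
      · exact Or.inl h.symm
      · rcases eq_or_lt_of_le h1i with h' | h'
        · exact Or.inr h'
        · exact absurd ⟨h, h'⟩ hnd
    have hs : Real.sqrt (p i * (1 - p i)) = 0 := by
      rcases hdeg with h | h <;> rw [h] <;> simp
    rw [hs]
    simp only [div_zero, mul_zero, add_zero, mul_one]
    rcases hdeg with hz | ho
    · cases b
      · cases b' <;> simp [coordWt, hz]
      · simp [coordWt, hz] at hb
    · cases b
      · simp [coordWt, ho] at hb
      · cases b' <;> simp [coordWt, ho]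

end Summit.CriticalPhenomena.PercolationContinuityZ3.Theorems.Crossing.Spectral

end
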